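import Summits.BirchSwinnertonDyer.BirchSwinnertonDyer.Theorems.ByReductionTypeAtTwoSupersingularFlatPairFun
import Literature.NumberTheory.EllipticCurves.Sprung2012.LocalTowerLayersProofs
import HarnessLib

/-!
# Route `ByReductionTypeAtTwo` (rung K4), crux `SupersingularRankZeroAtTwo` (item stmt-BirchSwinnertonDyer-19097), line
# `odd_blind_package` v2.20, stub 2/5 `stub_flatPackage : FlatZetaPackageAtTwo` — **THE PIN BRIDGE**: the registered stub quantifies over EVERY
# localisation `L : 𝐇¹ → Hom(E(ℚ_∞·ℚ_v), ℤ_p)` PINNED by its Tate-pairing residues (`toZModPow k (L x Q) = tatePairingPk n k (proj_n x) Q`); this file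
# proves that such an `L` IS the layer pairing family of the tree (`L x Q = pair n (proj_n x) Q` for every `pair` with the same residues — e.g. THE
# `SignedKatoOffTwo.LayerPairing.exists_linear_tatePairing` family that K3's CORE_KZ sockets and `pairFun` (★ p830262) are written over) and that two
# pinned `L`, `L'` agree on the whole tower — so the capstone hand may move every `pair`/`pairFun`-phrased tree statement onto the stub's `L` by `rw`
# (cell `bsd-2adic`, seat `bsd-2adic-ss-1` GEN 26 = LEAD of 19097; `--supports 19097`, helper)

HONEST FRAMING (D-0054): THEOREMS ONLY — no definition, no named fact, no instance, no notation, no `sorry`.  Elementary (`ℤ_p` is separated by its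
residues `PadicInt.ext_of_toZModPow`; every tower point lies on a layer).  Generic prime `p`, any `ℤ_p`-extension `κ` of `ℚ`, any place `v`, any pin
`I`.  Closes NO stub; 19097 stays OPEN on its 5 registered stubs (v2.20 39efd4f3); nothing booked; BSD₂ is proved for no supersingular curve and BSD for
no curve by any of this; typed ≠ proved.

References: [Kato2004Asterisque] §12.2 (p. 220), §17.13 (p. 279); [Kobayashi2003] (8.23) (p. 18); [PerrinRiou1994Invent] §3.6.1.
-/

set_option autoImplicit false
-- the Theorems namespace of this sub repeats the summit name by design (D-0017 nested layout)
set_option linter.dupNamespace false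

noncomputable section

open scoped Classical NumberField

namespace Summit.BirchSwinnertonDyer.BirchSwinnertonDyer.Theorems

namespace SSFlatFold

open Field NumberField IsDedekindDomain WeierstrassCurve
  Literature.NumberTheory.GaloisRepresentations
  Literature.NumberTheory.EllipticCurves Literature.NumberTheory.EllipticCurves.Kobayashi2003
  Literature.NumberTheory.EllipticCurves.Sprung2012 Literature.NumberTheory.EllipticCurves.Sprung2017
  Literature.NumberTheory.EllipticCurves.Kato2004 Literature.NumberTheory.EllipticCurves.Kato2004.EulerSystemValues ZpExtension

variable (W : WeierstrassCurve ℚ) [W.IsElliptic] {p : ℕ} [Fact p.Prime] [ContinuousSMul ℤ_[p] (W.tateModule p)]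
  (κ : ZpExtension ℚ p) (v : HeightOneSpectrum (𝓞 ℚ)) {γ : absoluteGaloisGroup ℚ}

/-- ★ **A pinned localisation IS the layer pairing**: if `pair n` has the Tate-pairing residues (`hres`, as delivered by
`SignedKatoOffTwo.LayerPairing.exists_linear_tatePairing` / `SSFlatPackage.exists_linearMap_pairFun_tatePairing`) and `L` has the registered pin of
`FlatZetaPackageAtTwo` (`toZModPow k (L x Q) = tatePairingPk n k (proj_n x) Q`), then `L x Q = pair n (proj_n x) Q` for every point `Q` of layer `n`
(`ℤ_p` is separated by its residues). [cite: Kato2004Asterisque, §12.2 (p. 220), §17.13 (p. 279)] [cite: Kobayashi2003, (8.23) (p. 18)] -/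
theorem apply_eq_pair_of_pin (I : IwasawaH1Data W p κ γ)
    (pair : ∀ n : ℕ, H1 (tateRep W p) (κ.layerSubgroup n) →ₗ[ℤ_[p]]
      (localLayerPointsOfEmb κ (closureEmb (K := ℚ) (v.adicCompletion ℚ)) W n →+ ℤ_[p]))
    (hres : ∀ (n k : ℕ) (x : H1 (tateRep W p) (κ.layerSubgroup n))
        (Q : localLayerPointsOfEmb κ (closureEmb (K := ℚ) (v.adicCompletion ℚ)) W n),
        PadicInt.toZModPow k (pair n x Q) = CyclotomicLayer.tatePairingPk W κ v n k x Q)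
    (L : I.H → (localTowerPointsOfEmb κ (closureEmb (K := ℚ) (v.adicCompletion ℚ)) W →+ ℤ_[p]))
    (hL : ∀ (x : I.H) (n k : ℕ) (Q : localPoints W (v.adicCompletion ℚ))
        (hQ : Q ∈ localLayerPointsOfEmb κ (closureEmb (K := ℚ) (v.adicCompletion ℚ)) W n),
        PadicInt.toZModPow k (L x ⟨Q, localLayerPointsOfEmb_le_localTowerPointsOfEmb κ _ W n hQ⟩) =
          CyclotomicLayer.tatePairingPk W κ v n k (I.proj n x) ⟨Q, hQ⟩)
    (x : I.H) (n : ℕ) (Q : localPoints W (v.adicCompletion ℚ))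
    (hQ : Q ∈ localLayerPointsOfEmb κ (closureEmb (K := ℚ) (v.adicCompletion ℚ)) W n) :
    L x ⟨Q, localLayerPointsOfEmb_le_localTowerPointsOfEmb κ _ W n hQ⟩ = pair n (I.proj n x) ⟨Q, hQ⟩ :=
  PadicInt.ext_of_toZModPow.1 fun k ↦ by rw [hL x n k Q hQ, hres]

/-- **Two pinned localisations agree on every tower point** (each tower point lies on some layer —
`exists_mem_localLayerPointsOfEmb_of_mem_localTowerPointsOfEmb`; the residues at that layer pin the value). [cite: Kato2004Asterisque, §12.2 (p. 220)]
[cite: Kobayashi2003, (8.23) (p. 18)] -/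
theorem apply_eq_apply_of_pin (I : IwasawaH1Data W p κ γ)
    (L L' : I.H → (localTowerPointsOfEmb κ (closureEmb (K := ℚ) (v.adicCompletion ℚ)) W →+ ℤ_[p]))
    (hL : ∀ (x : I.H) (n k : ℕ) (Q : localPoints W (v.adicCompletion ℚ))
        (hQ : Q ∈ localLayerPointsOfEmb κ (closureEmb (K := ℚ) (v.adicCompletion ℚ)) W n),
        PadicInt.toZModPow k (L x ⟨Q, localLayerPointsOfEmb_le_localTowerPointsOfEmb κ _ W n hQ⟩) =
          CyclotomicLayer.tatePairingPk W κ v n k (I.proj n x) ⟨Q, hQ⟩)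
    (hL' : ∀ (x : I.H) (n k : ℕ) (Q : localPoints W (v.adicCompletion ℚ))
        (hQ : Q ∈ localLayerPointsOfEmb κ (closureEmb (K := ℚ) (v.adicCompletion ℚ)) W n),
        PadicInt.toZModPow k (L' x ⟨Q, localLayerPointsOfEmb_le_localTowerPointsOfEmb κ _ W n hQ⟩) =
          CyclotomicLayer.tatePairingPk W κ v n k (I.proj n x) ⟨Q, hQ⟩)
    (x : I.H) (P : localTowerPointsOfEmb κ (closureEmb (K := ℚ) (v.adicCompletion ℚ)) W) : L x P = L' x P := by
  obtain ⟨n, hn⟩ := exists_mem_localLayerPointsOfEmb_of_mem_localTowerPointsOfEmb κ (closureEmb (K := ℚ) (v.adicCompletion ℚ)) W P.2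
  have hP : P = ⟨(P : localPoints W (v.adicCompletion ℚ)), localLayerPointsOfEmb_le_localTowerPointsOfEmb κ _ W n hn⟩ := rfl
  rw [hP]
  exact PadicInt.ext_of_toZModPow.1 fun k ↦ by rw [hL x n k _ hn, hL' x n k _ hn]

/-- **Hence two pinned localisations are EQUAL** (as functions `𝐇¹ → Hom(E(ℚ_∞·ℚ_v), ℤ_p)`): the registered stub's `∀ L, pin → …` is a statement
about ONE map — the `pairFun` of ★ p830262. [cite: Kato2004Asterisque, §12.2 (p. 220)] -/
theorem eq_of_pin (I : IwasawaH1Data W p κ γ)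
    (L L' : I.H → (localTowerPointsOfEmb κ (closureEmb (K := ℚ) (v.adicCompletion ℚ)) W →+ ℤ_[p]))
    (hL : ∀ (x : I.H) (n k : ℕ) (Q : localPoints W (v.adicCompletion ℚ))
        (hQ : Q ∈ localLayerPointsOfEmb κ (closureEmb (K := ℚ) (v.adicCompletion ℚ)) W n),
        PadicInt.toZModPow k (L x ⟨Q, localLayerPointsOfEmb_le_localTowerPointsOfEmb κ _ W n hQ⟩) =
          CyclotomicLayer.tatePairingPk W κ v n k (I.proj n x) ⟨Q, hQ⟩)
    (hL' : ∀ (x : I.H) (n k : ℕ) (Q : localPoints W (v.adicCompletion ℚ))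
        (hQ : Q ∈ localLayerPointsOfEmb κ (closureEmb (K := ℚ) (v.adicCompletion ℚ)) W n),
        PadicInt.toZModPow k (L' x ⟨Q, localLayerPointsOfEmb_le_localTowerPointsOfEmb κ _ W n hQ⟩) =
          CyclotomicLayer.tatePairingPk W κ v n k (I.proj n x) ⟨Q, hQ⟩) :
    L = L' :=
  funext fun x ↦ AddMonoidHom.ext fun P ↦ apply_eq_apply_of_pin W κ v I L L' hL hL' x P

/-- **The values of a pinned `L` at the Honda orbit read through `pair`**: for points `c n` of layer `n` and any `g`, `j`,
`L x (gʲ • c n) = pair n (proj_n x) (gʲ • c n)` — the shape in which E5's `hV` / K3's CORE_KZ address the functional `w := L x`.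
[cite: Kobayashi2003, (8.23) (p. 18)] [cite: Kato2004Asterisque, §17.13 (p. 279)] -/
theorem apply_smul_eq_pair_of_pin (I : IwasawaH1Data W p κ γ)
    (pair : ∀ n : ℕ, H1 (tateRep W p) (κ.layerSubgroup n) →ₗ[ℤ_[p]]
      (localLayerPointsOfEmb κ (closureEmb (K := ℚ) (v.adicCompletion ℚ)) W n →+ ℤ_[p]))
    (hres : ∀ (n k : ℕ) (x : H1 (tateRep W p) (κ.layerSubgroup n))
        (Q : localLayerPointsOfEmb κ (closureEmb (K := ℚ) (v.adicCompletion ℚ)) W n),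
        PadicInt.toZModPow k (pair n x Q) = CyclotomicLayer.tatePairingPk W κ v n k x Q)
    (L : I.H → (localTowerPointsOfEmb κ (closureEmb (K := ℚ) (v.adicCompletion ℚ)) W →+ ℤ_[p]))
    (hL : ∀ (x : I.H) (n k : ℕ) (Q : localPoints W (v.adicCompletion ℚ))
        (hQ : Q ∈ localLayerPointsOfEmb κ (closureEmb (K := ℚ) (v.adicCompletion ℚ)) W n),
        PadicInt.toZModPow k (L x ⟨Q, localLayerPointsOfEmb_le_localTowerPointsOfEmb κ _ W n hQ⟩) =
          CyclotomicLayer.tatePairingPk W κ v n k (I.proj n x) ⟨Q, hQ⟩)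
    {c : ℕ → localPoints W (v.adicCompletion ℚ)}
    (hc : ∀ n, c n ∈ localLayerPointsOfEmb κ (closureEmb (K := ℚ) (v.adicCompletion ℚ)) W n)
    (x : I.H) (n j : ℕ) (g : absoluteGaloisGroup (v.adicCompletion ℚ)) :
    L x ⟨g ^ j • c n, localLayerPointsOfEmb_le_localTowerPointsOfEmb κ _ W n
        (smul_mem_localLayerPointsOfEmb κ (closureEmb (K := ℚ) (v.adicCompletion ℚ)) W n (g ^ j) (hc n))⟩ =
      pair n (I.proj n x) ⟨g ^ j • c n, smul_mem_localLayerPointsOfEmb κ (closureEmb (K := ℚ) (v.adicCompletion ℚ)) W n (g ^ j) (hc n)⟩ :=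
  apply_eq_pair_of_pin W κ v I pair hres L hL x n _ _

end SSFlatFold

end Summit.BirchSwinnertonDyer.BirchSwinnertonDyer.Theorems

end
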